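import Literature.NumberTheory.PAdicHodge.TateLogCyclotomicClass
import Literature.NumberTheory.GaloisRepresentations.PAdicHodgeProofs
import Literature.NumberTheory.GaloisRepresentations.PadicAlgebraIntegral
import HarnessLib

/-!
# Kato's Prop. 1.2.3, injectivity half: `∪ log χ_cyclo` is injective on `D⁰_dR(V)` for de Rham `V`

Continuation of `TateLogCyclotomicClass` (Tate 1967 §3.3, the `H¹` half in the SCALAR case:
`[log χ] ≠ 0` in `H¹(Γ_F, ℂ_F)`) and of `BdRPeriodRingData` (`B_dR(F)^{Γ_F} = F`). Notation as there:
`F` a non-archimedean local field of characteristic `0` and residue characteristic `p`, `Γ_F = Gal(F̄/F)`,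
`B_dR⁺ = BDeRhamPlus (integerC F) p`, `B_dR = FracBdR F p`, `u = [ε] − 1` the uniformizer (`uBdR`),
`θ : B_dR⁺ → ℂ_F` (`thetaBdR`), `χ` the cyclotomic character, `log χ = logCyclotomic p : Γ_F → ℚ_p`.

We prove the INJECTIVITY HALF of

> **Kato, LNM 1553 (1993), Ch. II Prop. 1.2.3** (`i = 0`): for a de Rham representation `V` of `Γ_F`
> the cup product `x ↦ x ∪ log χ_cyclo`, `D⁰_dR(V) → H¹(F, B_dR⁺ ⊗ V)`, is an isomorphism,

in the tree's currency (`PeriodRingData.CupLogInjective`, file `BlochKatoDualExponential`), i.e. the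
first conjunct of the cite-only named fact
`Literature.NumberTheory.PAdicHodge.cupLogInjective_and_hasDualExp_of_isDeRham` (file `DualExpElliptic`),
for EVERY finite-dimensional de Rham `V` and every `ℚ_p`-algebra structure on `F`:

* `cupLogInjective_of_isDeRham` : `IsDeRham (bdRPeriodRingData hp) ρ →
  (bdRPeriodRingData hp).CupLogInjective (logCyclotomic p) ρ`.

Proof (three steps, no named facts used).
1. **`log χ` is not a coboundary in `B_dR(F)`** (`not_exists_smul_fracBdR_eq_add_logCyclotomic`): if
   `σ β − β = log χ(σ)` for all `σ`, with `β ∈ B_dR`, then either `β ∈ B_dR⁺`, and applying `θ` gives a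
   `c = θ β ∈ ℂ_F` with `σ c = c + log χ(σ)`, impossible by the scalar theorem
   `CompletedAlgClosure.not_exists_smul_eq_add_logCyclotomic_one` (file `TateLogCyclotomicClass`); or
   `β = u^{-n} w` with `n ≥ 1` and `w` a unit of `B_dR⁺` (`exists_eq_uBdR_zpow_mul`), and then — since
   `log χ(σ) · u^n ≡ 0` and `σ u = k_σ u`, `θ(k_σ) = χ(σ)` — applying `θ` gives `σ(θ w) = χ(σ)^n θ w` with
   `θ w ≠ 0`, impossible by Tate's `H⁰(Γ_F, ℂ_F(χ^n)) = 0`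
   (`CompletedAlgClosure.eq_zero_of_forall_smul_eq_cyclotomicCharacter_zpow`, file `TateTwistInvariants`).
   (This is the `H¹` twin of `exists_unit_of_forall_smul_eq` in `BdRPeriodRingData`.)
2. **Abstract step** (`PeriodRingData.cupLogInjective_of_isAdmissible_of_not_exists_smul_eq_add`), for any
   period-ring datum `𝔅` whose ring `B` is a field and any additive character `ψ`: if `ψ` is not a
   coboundary in `B` and `ρ` is `B`-admissible, then `CupLogInjective 𝔅 ψ ρ`. Indeed, by Fontaine's
   comparison (`dim_E D = dim V` plus the tree's injectivity `PeriodRingData.linearIndependent_of_mem_D`)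
   an `E`-basis `(dᵢ)` of `D(V)` is a `B`-basis of `B ⊗ V`, whose coordinate functions `λᵢ` are
   `Γ`-EQUIVARIANT (`λᵢ(σ y) = σ λᵢ(y)`, as the `dᵢ` are invariant); for `0 ≠ x = Σ aᵢ dᵢ ∈ D(V)`
   (`aᵢ ∈ E`, some `aᵢ ≠ 0`) a relation `ψ(σ) x = σ b − b` yields `ψ(σ) aᵢ = σ λᵢ(b) − λᵢ(b)`, so
   `β = λᵢ(b) aᵢ⁻¹` is a `B`-coboundary primitive of `ψ`. (The filtration plays no role: `log χ` is not a
   coboundary in all of `B_dR`, not only in `B_dR⁺`.)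
3. Assembly for `𝔅 = bdRPeriodRingData hp` (`B = Frac B_dR⁺` is a field; `IsDeRham = IsAdmissible`;
   `algebraMap ℚ_p F = padicRingHom` by the tree's rigidity `LocalField.ringHom_padic_ext`).

What is NOT here: the surjectivity half `HasDualExp` of Prop. 1.2.3 (it needs `H¹(Γ_F, ℂ_F(χ^j)) = 0` for
`j ≠ 0` and `H¹(Γ_F, ℂ_F) = F·[log χ]`, i.e. Tate–Sen's `H¹(Gal(F̄/F_∞), ℂ_F) = 0`, absent from the tree),
the statement for `i ≠ 0`, and the de Rham property of any particular `V` (e.g. `V_pE`, the cite-only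
`isDeRham_restrictedRationalTateRep`). So the named fact `cupLogInjective_and_hasDualExp_of_isDeRham`
is NOT discharged; its first conjunct is.

## References

* K. Kato, *Lectures on the approach to Iwasawa theory for Hasse–Weil L-functions via B_dR, I*,
  LNM 1553 (1993), Ch. II §1.2.2, Prop. 1.2.3, §1.2.4–1.2.7. [Kato1993LNM1553]
* J. Tate, *p-divisible groups* (1967), §3.3 Theorems 1–2. [Tate1967]
* J.-M. Fontaine, *Le corps des périodes p-adiques*; *Représentations p-adiques semi-stables*,
  Astérisque 223 (1994), Exp. II §1.5, Exp. III §1.5 (Thm. 1.5.2: admissible ⇒ comparison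
  isomorphism). [FontaineAsterisque223III]
* J.-M. Fontaine, Y. Ouyang, *Theory of p-adic Galois representations*, Thm. 3.14, §5.2. [FontaineOuyang2022]
-/

noncomputable section

open scoped TensorProduct

/-! ### Step 2 (abstract): admissible + `B` a field + `ψ` not a `B`-coboundary ⇒ `CupLogInjective` -/

namespace Literature.NumberTheory.GaloisRepresentations.PeriodRingData

section CupLog

-- Mathlib's own global value; needed for instance problems on `𝔅.B ⊗[P] M` (see `PAdicHodgeProofs`).
set_option maxSynthPendingDepth 3

universe u v v' w w'

variable {Γ : Type u} [Group Γ] [TopologicalSpace Γ] {P : Type v} {E : Type v'} [Field P]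
  [TopologicalSpace P] [Field E] [Algebra P E]
  {M : Type w'} [AddCommGroup M] [Module P M] [TopologicalSpace M]
  (𝔅 : PeriodRingData.{u, v, v', w} Γ P E) (ρ : ContinuousRep Γ P M)

omit [TopologicalSpace Γ] [TopologicalSpace P] in
/-- `Γ` fixes the scalars from `E` inside `B`: `σ • algebraMap E B e = algebraMap E B e` (`E = B^Γ`).
Ref: Fontaine, Astérisque 223 (1994), Exp. III §1.4 (`E`-linearity of the action on a regular
`(P, Γ)`-ring). [cite: FontaineAsterisque223III, Exp. III §1.4] -/
theorem smul_algebraMap_eq (σ : Γ) (e : E) : σ • algebraMap E 𝔅.B e = algebraMap E 𝔅.B e := by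
  rw [Algebra.algebraMap_eq_smul_one, smul_comm, smul_one]

/-- The diagonal action on a `B`-linear combination of INVARIANT vectors acts on the coefficients only:
`σ (Σ cᵢ dᵢ) = Σ σ(cᵢ) dᵢ` for `dᵢ ∈ D(V)` (the comparison map `α_V : B ⊗_E D → B ⊗_P V` is
`Γ`-equivariant for `σ ⊗ 1` on the source).
Ref: Fontaine, Astérisque 223 (1994), Exp. III §1.5.1 (`α_V` commutes with the action of `G`);
Fontaine–Ouyang Thm. 3.14. [cite: FontaineAsterisque223III, Exp. III §1.5.1] -/
theorem tensorRep_sum_smul_of_mem_D {ι : Type*} (s : Finset ι) (d : ι → 𝔅.B ⊗[P] M)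
    (hd : ∀ i, d i ∈ 𝔅.D ρ) (c : ι → 𝔅.B) (σ : Γ) :
    𝔅.tensorRep ρ σ (∑ i ∈ s, c i • d i) = ∑ i ∈ s, (σ • c i) • d i := by
  rw [map_sum]
  refine Finset.sum_congr rfl fun i _ => ?_
  rw [tensorRep_apply_smul, (𝔅.mem_D_iff ρ (d i)).mp (hd i) σ]

/-- **Fontaine's comparison isomorphism, basis form** (the equality case of `finrank_D_le`): if `B` is a
field and `ρ` is `B`-admissible (`dim_E D_B(V) = dim_P V`), every `E`-basis of `D_B(V)` is a `B`-basis of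
`B ⊗_P V` — it is `B`-linearly independent by `linearIndependent_of_mem_D` and has the right cardinality
`dim_P V = rank_B (B ⊗_P V)`.
Ref: Fontaine, Astérisque 223 (1994), Exp. III, Thm. 1.5.2 (`α_V` is an isomorphism iff `V` is
admissible); Fontaine–Ouyang Thm. 3.14 (2). [cite: FontaineAsterisque223III, Exp. III Thm. 1.5.2] -/
theorem exists_basis_extending_of_isAdmissible (hB : IsField 𝔅.B) [Module.Finite P M]
    (hadm : 𝔅.IsAdmissible ρ) {ι : Type*} [Fintype ι] [Nonempty ι] (bE : Module.Basis ι E (𝔅.D ρ)) :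
    ∃ 𝒷 : Module.Basis ι 𝔅.B (𝔅.B ⊗[P] M), ∀ i, 𝒷 i = (bE i : 𝔅.B ⊗[P] M) := by
  have hliE : LinearIndependent E (fun i => ((bE i : 𝔅.D ρ) : 𝔅.B ⊗[P] M)) :=
    bE.linearIndependent.map' (𝔅.D ρ).subtype (Submodule.ker_subtype _)
  have hliB : LinearIndependent 𝔅.B (fun i => ((bE i : 𝔅.D ρ) : 𝔅.B ⊗[P] M)) :=
    𝔅.linearIndependent_of_mem_D ρ (fun i => (bE i).2) hliE
  have hcard : Fintype.card ι = Module.finrank 𝔅.B (𝔅.B ⊗[P] M) := by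
    rw [Module.finrank_baseChange, ← hadm, Module.finrank_eq_card_basis bE]
  letI : Field 𝔅.B := hB.toField
  exact ⟨basisOfLinearIndependentOfCardEqFinrank hliB hcard,
    fun i => congrFun (coe_basisOfLinearIndependentOfCardEqFinrank hliB hcard) i⟩

/-- **The coordinates in an invariant basis are `Γ`-equivariant**: if `(𝒷ᵢ)` is a `B`-basis of `B ⊗_P V`
consisting of vectors of `D_B(V)`, then `𝒷.repr (σ y) i = σ (𝒷.repr y i)` — i.e. under the comparison
isomorphism `B ⊗_E D_B(V) ≅ B ⊗_P V` the diagonal action becomes `σ ⊗ 1`.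
Ref: Fontaine, Astérisque 223 (1994), Exp. III §1.5.1–1.5.2; Fontaine–Ouyang Thm. 3.14 (2).
[cite: FontaineAsterisque223III, Exp. III §1.5.1 and Thm. 1.5.2] -/
theorem repr_tensorRep_of_mem_D {ι : Type*} [Fintype ι] (𝒷 : Module.Basis ι 𝔅.B (𝔅.B ⊗[P] M))
    (h𝒷 : ∀ i, 𝒷 i ∈ 𝔅.D ρ) (σ : Γ) (y : 𝔅.B ⊗[P] M) (i : ι) :
    𝒷.repr (𝔅.tensorRep ρ σ y) i = σ • 𝒷.repr y i := by
  conv_lhs => rw [← 𝒷.sum_repr y, 𝔅.tensorRep_sum_smul_of_mem_D ρ Finset.univ 𝒷 h𝒷 _ σ,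
    𝒷.repr_sum_self]

/-- **Injectivity of `x ↦ x ∪ ψ` from a scalar non-coboundary statement.** Let `𝔅` be a period-ring
datum whose ring `B` is a field, `ρ` a finite-dimensional `B`-admissible representation and `ψ : Γ → P`
such that `ψ` (through `P → E → B`) is NOT a coboundary in `B`: there is no `β ∈ B` with
`σ β = β + ψ(σ)` for all `σ`. Then `𝔅.CupLogInjective ψ ρ`: a vector `x ∈ D_B(V)` for which
`σ ↦ ψ(σ) · x` is a coboundary (of `Fil⁰B ⊗ V`, or indeed of `B ⊗ V`) is zero. Proof: read the relation
`ψ(σ) x = σ b − b` in the equivariant coordinate `λᵢ` of an `E`-basis of `D_B(V)` (a `B`-basis of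
`B ⊗ V`, `exists_basis_extending_of_isAdmissible`) at an index where the `E`-coordinate `aᵢ` of `x` is
nonzero, and divide by `aᵢ`. For `B = B_dR`, `ψ = log χ_cyclo` this is the injectivity half of Kato's
Prop. 1.2.3 (`cupLogInjective_of_isDeRham` below). [cite: Kato1993LNM1553, Ch. II Prop. 1.2.3 and §1.2.6–1.2.7] -/
theorem cupLogInjective_of_isAdmissible_of_not_exists_smul_eq_add (hB : IsField 𝔅.B)
    [Module.Finite P M] (hadm : 𝔅.IsAdmissible ρ) (ψ : Γ → P)
    (hψ : ¬ ∃ β : 𝔅.B, ∀ σ : Γ, σ • β = β + algebraMap P 𝔅.B (ψ σ)) :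
    𝔅.CupLogInjective ψ ρ := by
  classical
  intro x hxD _ hcob
  by_contra hx0
  obtain ⟨b, -, hb⟩ := hcob
  -- `V ≠ 0`, so `D_B(V)` is finite-dimensional of positive dimension
  have hn : 0 < Module.finrank P M := by
    rcases subsingleton_or_nontrivial M with hM | hM
    · exfalso
      refine hx0 (x.induction_on rfl (fun c m => ?_) (fun y z hy hz => by rw [hy, hz, add_zero]))
      rw [Subsingleton.elim m 0, TensorProduct.tmul_zero]
    · exact Module.finrank_pos
  have hDpos : 0 < Module.finrank E (𝔅.D ρ) := by rw [hadm]; exact hn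
  haveI : Module.Finite E (𝔅.D ρ) := Module.finite_of_finrank_pos hDpos
  -- an `E`-basis of `D`, which is a `B`-basis of `B ⊗ V`
  set bE := Module.finBasis E (𝔅.D ρ)
  haveI : Nonempty (Fin (Module.finrank E (𝔅.D ρ))) := ⟨⟨0, hDpos⟩⟩
  obtain ⟨𝒷, h𝒷⟩ := 𝔅.exists_basis_extending_of_isAdmissible ρ hB hadm bE
  have h𝒷D : ∀ i, 𝒷 i ∈ 𝔅.D ρ := fun i => by rw [h𝒷 i]; exact (bE i).2
  -- the `E`-coordinates `a i` of `x`; they are its `B`-coordinates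
  set a : Fin (Module.finrank E (𝔅.D ρ)) → E := fun i => bE.repr ⟨x, hxD⟩ i with ha
  have hxsum : x = ∑ i, algebraMap E 𝔅.B (a i) • 𝒷 i := by
    have h1 : (⟨x, hxD⟩ : 𝔅.D ρ) = ∑ i, a i • bE i := (bE.sum_repr ⟨x, hxD⟩).symm
    have h2 := congrArg (fun z : 𝔅.D ρ => (z : 𝔅.B ⊗[P] M)) h1
    simp only [Submodule.coe_sum, Submodule.coe_smul] at h2
    rw [h2]
    exact Finset.sum_congr rfl fun i _ => by rw [algebraMap_smul, h𝒷 i]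
  have hxrepr : ∀ i, 𝒷.repr x i = algebraMap E 𝔅.B (a i) := fun i => by
    conv_lhs => rw [hxsum, 𝒷.repr_sum_self]
  -- some coordinate is nonzero
  obtain ⟨i, hi⟩ : ∃ i, a i ≠ 0 := by
    by_contra! hall
    exact hx0 (by rw [hxsum]; exact Finset.sum_eq_zero fun i _ => by rw [hall i, map_zero, zero_smul])
  have hAi : algebraMap E 𝔅.B (a i) ≠ 0 := by
    rw [Ne, map_eq_zero_iff _ (algebraMap E 𝔅.B).injective]; exact hi
  obtain ⟨A, hA⟩ := hB.mul_inv_cancel hAi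
  -- `A = (a i)⁻¹` is `Γ`-invariant
  have hσA : ∀ σ : Γ, σ • A = A := fun σ => by
    have h1 : algebraMap E 𝔅.B (a i) * σ • A = 1 := by
      conv_lhs => rw [← 𝔅.smul_algebraMap_eq σ (a i), ← smul_mul', hA, smul_one]
    calc σ • A = (A * algebraMap E 𝔅.B (a i)) * σ • A := by rw [mul_comm A, hA, one_mul]
      _ = A := by rw [mul_assoc, h1, mul_one]
  -- read the coboundary relation in the `i`-th coordinate
  have hcoord : ∀ σ : Γ, algebraMap P 𝔅.B (ψ σ) * algebraMap E 𝔅.B (a i) =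
      σ • 𝒷.repr b i - 𝒷.repr b i := fun σ => by
    have h1 := congrArg (fun z => 𝒷.repr z i) (hb σ)
    simp only at h1
    rw [map_sub, Finsupp.sub_apply, 𝔅.repr_tensorRep_of_mem_D ρ 𝒷 h𝒷D, ← algebraMap_smul 𝔅.B,
      map_smul, Finsupp.smul_apply, smul_eq_mul, hxrepr i] at h1
    rw [𝔅.algebraMap_eq]
    exact h1
  refine hψ ⟨𝒷.repr b i * A, fun σ => ?_⟩
  rw [smul_mul', hσA, ← sub_eq_iff_eq_add', ← sub_mul, ← hcoord σ, mul_assoc, hA, mul_one]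

end CupLog

end Literature.NumberTheory.GaloisRepresentations.PeriodRingData

/-! ### Step 1: `log χ_cyclo` is not a coboundary in `B_dR(F)` -/

namespace Literature.NumberTheory.PAdicHodge

open ValuativeRel Field Ideal WittVector UniformSpace
open Literature.NumberTheory.GaloisRepresentations
open Literature.NumberTheory.GaloisRepresentations.IsNonarchimedeanLocalField

variable {F : Type} [Field F] [ValuativeRel F] [TopologicalSpace F] [IsNonarchimedeanLocalField F]
  [CharZero F] {p : ℕ} [Fact p.Prime] [Fact (¬ IsUnit (p : integerC F))]
  [IsAdicComplete (Ideal.span {(p : integerC F)}) (integerC F)]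
  (hp : valuation F p < 1)

section FracBdR

variable (hF : Function.Surjective (fontaineTheta (integerC F) p)) [IsDomain (BDeRhamPlus (integerC F) p)]

set_option maxHeartbeats 400000 in
include hp hF in
/-- **`log χ_cyclo` is not a coboundary in `B_dR(F)`** (the `H¹` twin of `exists_unit_of_forall_smul_eq`):
there is no `β ∈ B_dR(F) = Frac B_dR⁺(F)` with `σ • β = β + log χ_F(σ)` for all `σ ∈ Γ_F` (the scalar
`log χ_F(σ) ∈ ℚ_p` mapped through `ℚ_p → F ↪ B_dR⁺ ⊆ B_dR` by `LocalField.padicRingHom` and `embBdRHom`).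
Proof: if `β ∈ B_dR⁺`, apply `θ` and use Tate's `[log χ] ≠ 0` in `H¹(Γ_F, ℂ_F)`
(`CompletedAlgClosure.not_exists_smul_eq_add_logCyclotomic_one`); otherwise `β = u^{-n} w` with `n ≥ 1`,
`w ∈ (B_dR⁺)ˣ`, and `θ` of `σ w = k_σ^n w + k_σ^n u^n log χ(σ)` reads `σ(θ w) = χ(σ)^n θ w`, `θ w ≠ 0`,
against Tate's `ℂ_F(χ^n)^{Γ_F} = 0` (`CompletedAlgClosure.eq_zero_of_forall_smul_eq_cyclotomicCharacter_zpow`).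
This is the `V = ℚ_p` case of the injectivity half of Kato's Prop. 1.2.3, read in all of `B_dR`
rather than `B_dR⁺`. [cite: Kato1993LNM1553, Ch. II Prop. 1.2.3 and §1.2.6–1.2.7] [cite: Tate1967, §3.3 Theorems 1–2] -/
theorem not_exists_smul_fracBdR_eq_add_logCyclotomic :
    ¬ ∃ β : FracBdR F p, ∀ σ : absoluteGaloisGroup F,
      σ • β = β + algebraMap (BDeRhamPlus (integerC F) p) (FracBdR F p)
        (embBdRHom hp hF (LocalField.padicRingHom F p hp (logCyclotomic p σ))) := by
  rintro ⟨β, hβ⟩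
  by_cases hrange : ∃ b : BDeRhamPlus (integerC F) p,
      algebraMap (BDeRhamPlus (integerC F) p) (FracBdR F p) b = β
  · -- `β ∈ B_dR⁺`: apply `θ`
    obtain ⟨b, rfl⟩ := hrange
    refine CompletedAlgClosure.not_exists_smul_eq_add_logCyclotomic_one hp ⟨thetaBdR b, fun σ => ?_⟩
    have h1 : galBdRPlus σ b = b + embBdRHom hp hF (LocalField.padicRingHom F p hp (logCyclotomic p σ)) :=
      algebraMap_fracBdR_injective (by rw [map_add, ← smul_algebraMap_fracBdR, hβ σ])
    have h2 := congrArg thetaBdR h1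
    rwa [thetaBdR_galBdRPlus, map_add, thetaBdR_embBdRHom] at h2
  · -- `β = u^m w` with `m < 0`
    have hβ0 : β ≠ 0 := fun h => hrange ⟨0, by rw [map_zero, h]⟩
    obtain ⟨m, w, rfl⟩ := exists_eq_uBdR_zpow_mul hF hβ0
    obtain ⟨n, hn⟩ : ∃ n : ℕ, m = -(n : ℤ) := by
      rcases lt_or_ge m 0 with hm | hm
      · exact ⟨(-m).toNat, by rw [Int.toNat_of_nonneg (by omega), neg_neg]⟩
      · exfalso
        obtain ⟨n, rfl⟩ := Int.eq_ofNat_of_zero_le hm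
        exact hrange ⟨uBdR ^ n * (w : BDeRhamPlus (integerC F) p), by rw [map_mul, map_pow, zpow_natCast]⟩
    subst hn
    have hn0 : n ≠ 0 := by
      rintro rfl
      exact hrange ⟨(w : BDeRhamPlus (integerC F) p), by rw [Nat.cast_zero, neg_zero, zpow_zero, one_mul]⟩
    set U : FracBdR F p := algebraMap (BDeRhamPlus (integerC F) p) (FracBdR F p) uBdR with hU
    have hU0 : U ≠ 0 := fun h => hβ0 (by rw [h, zero_zpow _ (by exact_mod_cast (neg_ne_zero.2 (Int.natCast_ne_zero.2 hn0))), zero_mul])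
    -- `θ(u) = 0` (`u = ξ v`)
    have hθu : thetaBdR (uBdR : BDeRhamPlus (integerC F) p) = 0 := by
      obtain ⟨v, -, huv⟩ := exists_uBdR_eq_xiBdR_mul (F := F) (p := p) hF
      rw [huv, map_mul, thetaBdR_xiBdR, zero_mul]
    -- for each `σ`: `σ(θ w) = χ(σ)^n θ w`
    have key : ∀ σ : absoluteGaloisGroup F, σ • thetaBdR (w : BDeRhamPlus (integerC F) p) =
        (algebraMap F (CompletedAlgClosure F)
          (LocalField.padicRingHom F p hp
            (((GaloisRep.cyclotomicCharacter F p σ : ℤ_[p]ˣ) : ℤ_[p]) : ℚ_[p]))) ^ (n : ℤ) *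
          thetaBdR (w : BDeRhamPlus (integerC F) p) := by
      intro σ
      obtain ⟨k, hk, hθk⟩ := exists_galBdRPlus_uBdR_eq_mul_cyclotomic hp hF σ
      set e : BDeRhamPlus (integerC F) p := embBdRHom hp hF (LocalField.padicRingHom F p hp (logCyclotomic p σ)) with he
      have hc0 : (algebraMap F (CompletedAlgClosure F)
          (LocalField.padicRingHom F p hp (((GaloisRep.cyclotomicCharacter F p σ : ℤ_[p]ˣ) : ℤ_[p]) : ℚ_[p]))) ≠ 0 := by
        rw [map_ne_zero_iff _ (algebraMap F (CompletedAlgClosure F)).injective,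
          map_ne_zero_iff _ (LocalField.padicRingHom F p hp).injective]
        exact PadicInt.coe_ne_zero.2 (GaloisRep.cyclotomicCharacter F p σ).ne_zero
      have hk0 : algebraMap (BDeRhamPlus (integerC F) p) (FracBdR F p) k ≠ 0 := by
        rw [map_ne_zero_iff _ algebraMap_fracBdR_injective]
        rintro rfl
        rw [map_zero] at hθk
        exact hc0 hθk.symm
      -- the relation in `B_dR`
      have h1 := hβ σ
      rw [smul_mul', smul_fracBdR_eq_toRingHom σ (_ ^ (-(n : ℤ))), map_zpow₀, ← smul_fracBdR_eq_toRingHom,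
        smul_algebraMap_fracBdR, smul_algebraMap_fracBdR, hk, map_mul, mul_zpow, ← hU, ← he] at h1
      -- clear denominators: `σ w = k^n w + k^n u^n e` in `B_dR`
      have h2 : algebraMap (BDeRhamPlus (integerC F) p) (FracBdR F p) (galBdRPlus σ (w : BDeRhamPlus (integerC F) p)) =
          algebraMap (BDeRhamPlus (integerC F) p) (FracBdR F p) k ^ n *
              algebraMap (BDeRhamPlus (integerC F) p) (FracBdR F p) (w : BDeRhamPlus (integerC F) p) +
            algebraMap (BDeRhamPlus (integerC F) p) (FracBdR F p) k ^ n * U ^ n *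
              algebraMap (BDeRhamPlus (integerC F) p) (FracBdR F p) e := by
        rw [zpow_neg, zpow_neg, zpow_natCast, zpow_natCast] at h1
        have hKn : algebraMap (BDeRhamPlus (integerC F) p) (FracBdR F p) k ^ n ≠ 0 := pow_ne_zero _ hk0
        have hUn : U ^ n ≠ 0 := pow_ne_zero _ hU0
        calc algebraMap (BDeRhamPlus (integerC F) p) (FracBdR F p) (galBdRPlus σ (w : BDeRhamPlus (integerC F) p))
            = (algebraMap (BDeRhamPlus (integerC F) p) (FracBdR F p) k ^ n * U ^ n) *
                ((algebraMap (BDeRhamPlus (integerC F) p) (FracBdR F p) k ^ n)⁻¹ * (U ^ n)⁻¹ *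
                  algebraMap (BDeRhamPlus (integerC F) p) (FracBdR F p) (galBdRPlus σ (w : BDeRhamPlus (integerC F) p))) := by
              field_simp
          _ = (algebraMap (BDeRhamPlus (integerC F) p) (FracBdR F p) k ^ n * U ^ n) *
                ((U ^ n)⁻¹ * algebraMap (BDeRhamPlus (integerC F) p) (FracBdR F p) (w : BDeRhamPlus (integerC F) p) +
                  algebraMap (BDeRhamPlus (integerC F) p) (FracBdR F p) e) := by rw [h1]
          _ = _ := by field_simp
      have h3 : galBdRPlus σ (w : BDeRhamPlus (integerC F) p) =
          k ^ n * (w : BDeRhamPlus (integerC F) p) + k ^ n * uBdR ^ n * e :=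
        algebraMap_fracBdR_injective (by simpa only [map_add, map_mul, map_pow] using h2)
      have h4 := congrArg thetaBdR h3
      rw [thetaBdR_galBdRPlus] at h4
      simp only [map_add, map_mul, map_pow] at h4
      rw [hθk, hθu, zero_pow hn0, mul_zero, zero_mul, add_zero] at h4
      rw [zpow_natCast]
      exact h4
    have hzero := CompletedAlgClosure.eq_zero_of_forall_smul_eq_cyclotomicCharacter_zpow hp
      (j := (n : ℤ)) (Int.natCast_ne_zero.2 hn0) key
    exact ((isUnit_iff_thetaBdR_ne_zero hF _).1 w.isUnit) hzero

end FracBdR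

/-! ### Step 3: assembly for the period-ring datum `bdRPeriodRingData hp` -/

/-- **`log χ_cyclo` is not a coboundary in the period ring of `bdRPeriodRingData hp`**, for every
`ℚ_p`-algebra structure on `F` (the scalar `log χ(σ)` mapped by `ℚ_p → F → B_dR(F)`; `algebraMap ℚ_p F`
is the canonical embedding by the rigidity `LocalField.ringHom_padic_ext`).
[cite: Kato1993LNM1553, Ch. II Prop. 1.2.3] [cite: Tate1967, §3.3 Theorem 1] -/
theorem not_exists_smul_eq_add_logCyclotomic_bdRPeriodRingData [Algebra ℚ_[p] F] :
    ¬ ∃ β : (bdRPeriodRingData (F := F) (p := p) hp).B, ∀ σ : absoluteGaloisGroup F,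
      σ • β = β + algebraMap ℚ_[p] (bdRPeriodRingData (F := F) (p := p) hp).B (logCyclotomic p σ) := by
  have hF : Function.Surjective (fontaineTheta (integerC F) p) := surjective_fontaineTheta_integerC hp
  haveI : IsDomain (BDeRhamPlus (integerC F) p) := isDomain_bDeRhamPlus hF
  rintro ⟨β, hβ⟩
  refine not_exists_smul_fracBdR_eq_add_logCyclotomic hp hF ⟨β, fun σ => ?_⟩
  have h := hβ σ
  rw [PeriodRingData.algebraMap_eq,
    RingHom.congr_fun (LocalField.ringHom_padic_ext (algebraMap ℚ_[p] F) (LocalField.padicRingHom F p hp))] at h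
  exact h

/-- **Kato, LNM 1553, Ch. II Prop. 1.2.3 — injectivity half, PROVED**: for a `p`-adic field `F` (any
`ℚ_p`-algebra structure) and a finite-dimensional de Rham representation `V` of `Γ_F` (`IsDeRham` for the
tree's `B_dR(F)` = `bdRPeriodRingData hp`), the cup product `x ↦ x ∪ log χ_cyclo` is injective on
`D⁰_dR(V)` with values in `H¹(F, B_dR⁺ ⊗ V)`, in the tree's form `CupLogInjective`: if `x ∈ D_dR(V) ∩
(B_dR⁺ ⊗ V)` and `σ ↦ log χ(σ) · x` is a coboundary of `B_dR⁺ ⊗ V`, then `x = 0`. This is the first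
conjunct of the cite-only named fact `cupLogInjective_and_hasDualExp_of_isDeRham` (file `DualExpElliptic`),
for every de Rham `V`; the second conjunct (`HasDualExp`, surjectivity) is not proved here.
[cite: Kato1993LNM1553, Ch. II Prop. 1.2.3] -/
theorem cupLogInjective_of_isDeRham [Algebra ℚ_[p] F]
    {M : Type} [AddCommGroup M] [Module ℚ_[p] M] [TopologicalSpace M] [Module.Finite ℚ_[p] M]
    (ρ : GaloisRep F ℚ_[p] M) (hρ : GaloisRep.IsDeRham (bdRPeriodRingData (F := F) (p := p) hp) ρ) :
    (bdRPeriodRingData (F := F) (p := p) hp).CupLogInjective (logCyclotomic p) ρ := by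
  have hF : Function.Surjective (fontaineTheta (integerC F) p) := surjective_fontaineTheta_integerC hp
  haveI : IsDomain (BDeRhamPlus (integerC F) p) := isDomain_bDeRhamPlus hF
  have hB : IsField (bdRPeriodRingData (F := F) (p := p) hp).B := Field.toIsField (FracBdR F p)
  exact PeriodRingData.cupLogInjective_of_isAdmissible_of_not_exists_smul_eq_add _ ρ hB hρ
    (logCyclotomic p) (not_exists_smul_eq_add_logCyclotomic_bdRPeriodRingData hp)

end Literature.NumberTheory.PAdicHodge

end
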